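import Summits.ABC.IUTFork.Repair.RHReachLedgerQ2
import Summits.ABC.IUTFork.Conditional.AbcOfSGenuineKWindowThetaContent
import HarnessLib

/-!
# R-H ROUND 2 Q2(27) — THE R14 RECUT of row 27's abc END: `Cor 3.12 on Σ₂₇ ⟹ abc` with the CONE binder cut to the SZPIRO-BAD locus
# (`hregBad`) and to the CONTENT locus (`hregC`, the R14′ target of record), instead of the blanket `hreg`

PROOF-ONLY file (0 definitions, 0 `Prop` facts, no instance, no notation; abc-iut cell, D-0079 RESCUE sub-cell R-H, rung LADDER-ABC:A2.RESCUE.H;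
pair n = 10 typer abc-iut-rh-typ-10, author of the Q2(27) targets `Repair/RHReachLedgerQ2.lean` (p468994) and of the last arrow
`Repair/RHReachLedgerQ2Genuine.lean` (p477080)). TAKES NO SIDE on [IUTchIII] Cor. 3.12 / [IUTchIV] Thm. 1.10 or on any author (Mochizuki /
Scholze–Stix / Joshi / Dupuy–Hilado); typed ≠ proved; instantiated ≠ endorsed; nothing here asserts abc proved or refuted.

WHY THIS FILE (rh-lead RULING R14 (STATUS 2026-08-26T23:54Z) + R14′; abc-iut-D-ref-3 00:37:53Z «R14-GAP (1)»; abc-iut-rh-ref-3 00:23:41Z «NOTE FOR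
THE RECUT QUEUE»). p468994's two abc ends `abc_of_cor312OnSigma27` / `abc_of_k2Target27_of_hStar27OnSigma27` take the cone binder `hreg` of the
branch-C certificates VERBATIM — the BLANKET hull estimate demanded at EVERY admissible `(P, l)` — which abc-iut-s2-p5's `Conditional.not_hreg_v4`
(p453135) REFUTES as typed (an explicit admissible `d_mod = 2` family with a mixed prime). Those two theorems are therefore kernel-true
COMPOSITION RECORDS, VACUOUS AS TYPED in the [CONE] binder. This file re-derives the same abc ends over the two guarded cone binders of record,
which `not_hreg_v4` does NOT close:
* `hregC` — the hull estimate with print's `B_III(P, l)` off the slot-constant regime demanded ONLY on the CONTENT LOCUS of [IUTchIV]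
  Thm. 1.10's display («`6·(1 + 20·d_mod/l)·(log-diff + log-cond) + 120·d*_mod·l < log q^{∤{2,l}}(λ)`»), abc-iut-C-cert-1's binder of
  `Conditional.ABC_of_cor312C_of_hullRegimeC` (p460293) VERBATIM — the R14′ TARGET OF RECORD (θ-cut);
* `hregBad` — the same demanded ONLY at SZPIRO-BAD admissible `(P, l)` («`(l+5)/4 < d_mod ∨ … < log q^{∤{2,l}}(λ)`», the guard text of Σ₂₇'s
  own antecedents), abc-iut-s2-p2's binder of `ThetaPartII.ABC_of_cor312Bad_of_hullRegimeBad` VERBATIM.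
THE THEOREMS (all λ-terms / case splits over landed tails; no arithmetic of the chain of record is touched):
* §1 `abc_of_cor312NonarchOf_content_hregC` — the LEANEST row-27 abc end: [C312, window ∧ content] the NUMBER-level Cor. 3.12 `T.Cor312NonarchOf`
  at admissible data OFF the depth locus of points ON the content locus · [NUM, deep ∧ content] `T.Cor312Of` ON the depth locus there · [CONE-C]
  `hregC` ⟹ `ABC` (abc-iut-C-cert-1's θ-cut tail `ABC_of_cor312C_of_hullRegimeC`; per datum `Cor22.ThetaVolumeDatumAt.cor312Of_of_nonarch`).
  Explicit 3 = C312(window ∧ content) · NUM(deep ∧ content) · CONE(content); at every admissible `(P, l)` with `log q^{∤{2,l}}(λ) ≤ 120·d*_mod·l`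
  NOTHING is assumed.
* §2 `abc_of_cor312OnSigma27_content_hregC` — p468994's `Cor312OnSigma27` BY NAME (Cor 3.12 on Σ₂₇ = Szpiro-bad ∧ window ⊇ content ∧ window,
  abc-iut-C-cert-1's `szpiroBad_of_content`) · NUM(deep ∧ content) · CONE-C ⟹ `ABC`; and `abc_of_cor312OnSigma27_hregBad` — THE GUARD-ONLY DELTA of
  p468994's `abc_of_cor312OnSigma27`: `Cor312OnSigma27` · NUM(deep ∧ bad) (p468994's `hNumBad` VERBATIM) · CONE-bad `hregBad` ⟹ `ABC` (a λ-term over the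
  content line; equivalently `ThetaPartII.ABC_of_cor312Bad_of_hullRegimeBad`).
* §3 composites with the first arrow: `abc_of_k2Target27_of_hStar27OnSigma27_hregBad` / `…_content_hregC` (`K2Target27 ∧ HStar27OnSigma27 ∧ NUM ∧
  CONE-cut ⟹ ABC`) — p468994's `abc_of_k2Target27_of_hStar27OnSigma27` with ONLY the cone binder's guard changed. (The EXPLICIT-4 recut over
  p477080's `k2Target27_of_certificates` — H⋆₂₇|Σ₂₇ · certificates|Σ₂₇ · NUM · CONE-cut ⟹ `ABC` — is the sibling `Repair/RHReachLedgerQ2GenuineAbcRecut.lean`.)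
READING. With this file row 27's abc end of record rides `hregBad` / `hregC` like every other R-H row after R14 (hull lane p475597 / p476057,
cond lane p476943, eq lane p477420, rows 5 / 8 recuts); p468994's blanket-`hreg` theorems stay in the tree as typed (true, vacuous in [CONE]) and
are superseded here. `hregBad` / `hregC` are ASSUMPTION LABELS: neither proved nor refuted as typed; their truth at Szpiro-bad / content points
with a mixed prime is governed by abc-iut-s2-p1's sharp necessity (`pointMixedShare_le_slack_of_hreg`) — a Szpiro-type statement, not claimed.
H⋆₂₇ (`HStar27OnSigma27`, row 27 «reach-ledger», abc-iut-lens-nearmiss-1), `K2Target27`, `Cor312OnSigma27` and the certificates are HYPOTHESIS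
SHAPES over OUR typed objects (Dupuy–Hilado (Ind2) = all `ℤ_p`-lattice automorphisms, STRONGER-THAN-PRINT; SHARP boxes; volume reading of Step
(xi)); which genuine data satisfy them is rh-num-1's table (k1 74.8 % pooled / 98.9 % on frey Szpiro-bad ∧ window), not a theorem here.
[cite: Mochizuki2012, IUTchIII Cor. 3.12 p. 173–174; IUTchIV Thm. 1.10 p. 22–23, Steps (v) p. 27–28, (viii) p. 30; Cor. 2.2 (ii)–(iii) p. 43–47]
[cite: DupuyHilado2025, §1 (1.1), §3.9] [claim: Mochizuki2012, status: disputed] for every IUT sentence quoted. Axioms: standard.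
-/

noncomputable section

open Set Function NumberField IsDedekindDomain

namespace Summit.ABC.IUTFork.Repair.RH.ReachLedgerQ2

open Thm311 Thm311.Real Cor312 Cor312Vol Cor312Prov Literature.IUT.LogThetaLattice Literature.IUT.LogVolume
  Literature.IUT.HodgeTheaters Literature.IUT.LogVolume.ThetaData Summit.ABC.IUTFork.Repair.RH.ReachLedger
open Literature.NumberTheory.DiophantineGeometry Literature.NumberTheory.DiophantineGeometry.GenEll Summit.ABC.ABC.Theorems
  Summit.ABC.IUTFork.Conditional
open scoped Classical

/-! ## §1. The leanest row-27 abc end: number-level Cor. 3.12 off the depth locus, θ-cut (R14′ content line) -/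

/-- **`abc_of_cor312NonarchOf_content_hregC` — ROW 27's abc END ON THE CONTENT LINE (R14′ target of record).** `ABC` from three binders, each
demanded ONLY at admissible `(P, l)` ON THE CONTENT LOCUS of [IUTchIV] Thm. 1.10's display («`6·(1 + 20·d_mod/l)·(log-diff + log-cond) +
120·d*_mod·l < log q^{∤{2,l}}(λ)`»; off it the display holds by its own constant, abc-iut-C-cert-1's `display_of_not_content`): [C312, window ∧ content]
the NUMBER-level [IUTchIII] Cor. 3.12 `T.Cor312NonarchOf` (Dupuy–Hilado (1.1) for the datum's genuine input — what row 27's first arrow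
`K2Target27` delivers from the ledger) at every Θ-volume datum OFF the depth locus; [NUM, deep ∧ content] the number-level Corollary `T.Cor312Of` ON
the depth locus (text of p453137's `hNumBad` with the content guard, = abc-iut-C-cert-1's `hNumC` VERBATIM); [CONE-C] `hregC`, abc-iut-C-cert-1's
binder of `Conditional.ABC_of_cor312C_of_hullRegimeC` VERBATIM. Per datum: `Cor22.ThetaVolumeDatumAt.cor312Of_of_nonarch` off the depth locus,
`hNumC` on it; then the θ-cut tail. Explicit 3 = C312(window ∧ content) · NUM(deep ∧ content) · CONE(content). «`ABC` follows from these
hypotheses AS TYPED»; `hregC` is neither proved nor refuted as typed (`Conditional.not_hreg_v4` refutes only the blanket `hreg`); no side taken on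
[IUTchIII] Cor. 3.12 or [IUTchIV] Thm. 1.10. [cite: Mochizuki2012, IUTchIII Cor. 3.12 p. 173–174; IUTchIV Thm. 1.10 Step (viii) p. 30; Cor. 2.2 (ii) p. 46]
[cite: DupuyHilado2025, §1 (1.1)] [claim: Mochizuki2012, status: disputed] -/
theorem abc_of_cor312NonarchOf_content_hregC
    -- [C312, WINDOW ∧ CONTENT] the NUMBER-level Corollary 3.12 `T.Cor312NonarchOf`, ONLY at admissible data OFF the depth locus of points ON the content locus
    (h312C : ∀ (P : NFPoint), P ∈ UP → ∀ (l : ℕ), l.Prime → 5 ≤ l →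
      Cor22.AdmitsCore P → Cor22.CondP2 P l → Cor22.CondP5 P l → Cor22.CondP6 P l →
      -- ONLY on the CONTENT LOCUS of [IUTchIV] Thm. 1.10's display (`display_of_not_content`: off it the display holds for every `η > 0`)
      6 * ((1 + 20 * (Cor22.dmod P : ℝ) / l) * (P.logDiff + Cor22.logCondAvoid P {2, l}))
          + 120 * (2 ^ 12 * 3 ^ 3 * 5 * (Cor22.dmod P : ℝ) * l) < Cor22.logQAvoid P {2, l} →
      ∀ (T : Cor22.ThetaVolumeDatumAt P l), letI := T.instFieldF; letI := T.instNumberFieldF; letI := T.instAlgebraF; letI := T.instFieldK;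
        letI := T.instNumberFieldK; letI := T.instAlgebraK; letI := T.instFieldFbar; letI := T.instAlgebraFbar;
        letI := T.instAlgebraKFbar; letI := T.instIsElliptic;
      ¬ (∃ (pp : Nat.Primes) (_ : 2 < (pp : ℕ)) (i : Fin (thetaIndex (pilotDataOfK T.D T.K)).lstar)
          (x₀ : (thetaIndex (pilotDataOfK T.D T.K)).Fibre (.inr pp)),
        haveI : Fact (pp : ℕ).Prime := ⟨pp.2⟩
        ((pp : ℕ) : ℝ) ^ ((((i : ℕ) : ℝ) + 2) * (4 + 2 * Real.logb (pp : ℕ) (Module.finrank ℚ T.K)) + 1) *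
          ‖(exists_realising_qIdeles_pilotDataOfK T.D).choose pp x₀‖ ^ (((i : ℕ) + 1) ^ 2 - 1) < 1) →
      T.Cor312NonarchOf)
    -- [NUM, DEEP ∧ CONTENT] the NUMBER-level Corollary 3.12, ONLY at admissible data ON the depth locus of points ON the content locus
    (hNumC : ∀ (P : NFPoint), P ∈ UP → ∀ (l : ℕ), l.Prime → 5 ≤ l →
      Cor22.AdmitsCore P → Cor22.CondP2 P l → Cor22.CondP5 P l → Cor22.CondP6 P l →
      -- ONLY on the CONTENT LOCUS of [IUTchIV] Thm. 1.10's display (`display_of_not_content`: off it the display holds for every `η > 0`)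
      6 * ((1 + 20 * (Cor22.dmod P : ℝ) / l) * (P.logDiff + Cor22.logCondAvoid P {2, l}))
          + 120 * (2 ^ 12 * 3 ^ 3 * 5 * (Cor22.dmod P : ℝ) * l) < Cor22.logQAvoid P {2, l} →
      ∀ (T : Cor22.ThetaVolumeDatumAt P l), letI := T.instFieldF; letI := T.instNumberFieldF; letI := T.instAlgebraF; letI := T.instFieldK;
        letI := T.instNumberFieldK; letI := T.instAlgebraK; letI := T.instFieldFbar; letI := T.instAlgebraFbar;
        letI := T.instAlgebraKFbar; letI := T.instIsElliptic;
      (∃ (pp : Nat.Primes) (_ : 2 < (pp : ℕ)) (i : Fin (thetaIndex (pilotDataOfK T.D T.K)).lstar)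
          (x₀ : (thetaIndex (pilotDataOfK T.D T.K)).Fibre (.inr pp)),
        haveI : Fact (pp : ℕ).Prime := ⟨pp.2⟩
        ((pp : ℕ) : ℝ) ^ ((((i : ℕ) : ℝ) + 2) * (4 + 2 * Real.logb (pp : ℕ) (Module.finrank ℚ T.K)) + 1) *
          ‖(exists_realising_qIdeles_pilotDataOfK T.D).choose pp x₀‖ ^ (((i : ℕ) + 1) ^ 2 - 1) < 1) → T.Cor312Of)
    -- [CONE, CONTENT] the hull estimate with print's `B_III(P,l)` off the slot-constant regime, ONLY at admissible points ON the content locus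
    (hregC : ∀ P : NFPoint, P ∈ UP → ∀ l : ℕ, l.Prime → 5 ≤ l →
      Cor22.AdmitsCore P → Cor22.CondP2 P l → Cor22.CondP5 P l → Cor22.CondP6 P l →
      6 * ((1 + 20 * (Cor22.dmod P : ℝ) / l) * (P.logDiff + Cor22.logCondAvoid P {2, l}))
          + 120 * (2 ^ 12 * 3 ^ 3 * 5 * (Cor22.dmod P : ℝ) * l) < Cor22.logQAvoid P {2, l} →
      ∀ T : Cor22.ThetaVolumeDatumAt P l,
        (letI := T.instFieldF; letI := T.instNumberFieldF; letI := T.instAlgebraF; letI := T.instFieldK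
         letI := T.instNumberFieldK; letI := T.instAlgebraK; letI := T.instFieldFbar; letI := T.instAlgebraFbar
         letI := T.instAlgebraKFbar; letI := T.instIsElliptic
         ¬ (∀ p ∈ T.I.supportPrimes, ∀ v w : placesOver (fieldOfModuli T.E) p,
            (Summit.ABC.IUTFork.DHData.ofInput T.I).logQloc p v = (Summit.ABC.IUTFork.DHData.ofInput T.I).logQloc p w)) →
        T.HullEstimateOf
          (((l : ℝ) + 1) / 4 *
            ((1 + 12 * (Cor22.dmod P : ℝ) / l) * (P.logDiff + Cor22.logCondAvoid P {2, l})
              + 2 * Real.log l + 52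
              + 20 / 3 * Real.log (((2 ^ 12 * 3 ^ 3 * 5 * Cor22.dmod P : ℕ) : ℝ) * (l : ℝ))
                * (Nat.primeCounting (2 ^ 12 * 3 ^ 3 * 5 * Cor22.dmod P * l) : ℝ))))
    : _root_.ABC := by
  refine ABC_of_cor312C_of_hullRegimeC (fun P hP l hl h5 hc h2 h5' h6 hct T => ?_) hregC
  letI := T.instFieldF; letI := T.instNumberFieldF; letI := T.instAlgebraF; letI := T.instFieldK
  letI := T.instNumberFieldK; letI := T.instAlgebraK; letI := T.instFieldFbar; letI := T.instAlgebraFbar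
  letI := T.instAlgebraKFbar; letI := T.instIsElliptic
  by_cases hdeep : (∃ (pp : Nat.Primes) (_ : 2 < (pp : ℕ)) (i : Fin (thetaIndex (pilotDataOfK T.D T.K)).lstar)
        (x₀ : (thetaIndex (pilotDataOfK T.D T.K)).Fibre (.inr pp)),
      haveI : Fact (pp : ℕ).Prime := ⟨pp.2⟩
      ((pp : ℕ) : ℝ) ^ ((((i : ℕ) : ℝ) + 2) * (4 + 2 * Real.logb (pp : ℕ) (Module.finrank ℚ T.K)) + 1) *
        ‖(exists_realising_qIdeles_pilotDataOfK T.D).choose pp x₀‖ ^ (((i : ℕ) + 1) ^ 2 - 1) < 1)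
  · exact hNumC P hP l hl h5 hc h2 h5' h6 hct T hdeep
  · exact T.cor312Of_of_nonarch (h312C P hP l hl h5 hc h2 h5' h6 hct T hdeep)

/-! ## §2. `Cor312OnSigma27` BY NAME: the θ-cut, and the guard-only delta of p468994's `abc_of_cor312OnSigma27` (`hreg ↦ hregBad`) -/

/-- **`abc_of_cor312OnSigma27_content_hregC`** — «Cor 3.12 on Σ₂₇» (p468994's `Cor312OnSigma27`: `T.Cor312NonarchOf` at every admissible
SZPIRO-BAD `(P, l)` and datum OFF the depth locus) · [NUM, deep ∧ content] · [CONE-C] `hregC` ⟹ `ABC`. A λ-term over §1: the content guard implies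
the Szpiro-bad guard (abc-iut-C-cert-1's `szpiroBad_of_content`), so `Cor312OnSigma27` serves the [C312, window ∧ content] binder. Explicit 3 =
C312(Σ₂₇) · NUM(deep ∧ content) · CONE(content). «`ABC` follows from these hypotheses AS TYPED»; nothing asserted about any of them; no side taken.
[cite: Mochizuki2012, IUTchIII Cor. 3.12 p. 173–174; IUTchIV Thm. 1.10 Step (viii) p. 30] [claim: Mochizuki2012, status: disputed] -/
theorem abc_of_cor312OnSigma27_content_hregC (h312 : Cor312OnSigma27)
    -- [NUM, DEEP ∧ CONTENT] the NUMBER-level Corollary 3.12, ONLY at admissible data ON the depth locus of points ON the content locus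
    (hNumC : ∀ (P : NFPoint), P ∈ UP → ∀ (l : ℕ), l.Prime → 5 ≤ l →
      Cor22.AdmitsCore P → Cor22.CondP2 P l → Cor22.CondP5 P l → Cor22.CondP6 P l →
      -- ONLY on the CONTENT LOCUS of [IUTchIV] Thm. 1.10's display (`display_of_not_content`: off it the display holds for every `η > 0`)
      6 * ((1 + 20 * (Cor22.dmod P : ℝ) / l) * (P.logDiff + Cor22.logCondAvoid P {2, l}))
          + 120 * (2 ^ 12 * 3 ^ 3 * 5 * (Cor22.dmod P : ℝ) * l) < Cor22.logQAvoid P {2, l} →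
      ∀ (T : Cor22.ThetaVolumeDatumAt P l), letI := T.instFieldF; letI := T.instNumberFieldF; letI := T.instAlgebraF; letI := T.instFieldK;
        letI := T.instNumberFieldK; letI := T.instAlgebraK; letI := T.instFieldFbar; letI := T.instAlgebraFbar;
        letI := T.instAlgebraKFbar; letI := T.instIsElliptic;
      (∃ (pp : Nat.Primes) (_ : 2 < (pp : ℕ)) (i : Fin (thetaIndex (pilotDataOfK T.D T.K)).lstar)
          (x₀ : (thetaIndex (pilotDataOfK T.D T.K)).Fibre (.inr pp)),
        haveI : Fact (pp : ℕ).Prime := ⟨pp.2⟩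
        ((pp : ℕ) : ℝ) ^ ((((i : ℕ) : ℝ) + 2) * (4 + 2 * Real.logb (pp : ℕ) (Module.finrank ℚ T.K)) + 1) *
          ‖(exists_realising_qIdeles_pilotDataOfK T.D).choose pp x₀‖ ^ (((i : ℕ) + 1) ^ 2 - 1) < 1) → T.Cor312Of)
    -- [CONE, CONTENT] the hull estimate with print's `B_III(P,l)` off the slot-constant regime, ONLY at admissible points ON the content locus
    (hregC : ∀ P : NFPoint, P ∈ UP → ∀ l : ℕ, l.Prime → 5 ≤ l →
      Cor22.AdmitsCore P → Cor22.CondP2 P l → Cor22.CondP5 P l → Cor22.CondP6 P l →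
      6 * ((1 + 20 * (Cor22.dmod P : ℝ) / l) * (P.logDiff + Cor22.logCondAvoid P {2, l}))
          + 120 * (2 ^ 12 * 3 ^ 3 * 5 * (Cor22.dmod P : ℝ) * l) < Cor22.logQAvoid P {2, l} →
      ∀ T : Cor22.ThetaVolumeDatumAt P l,
        (letI := T.instFieldF; letI := T.instNumberFieldF; letI := T.instAlgebraF; letI := T.instFieldK
         letI := T.instNumberFieldK; letI := T.instAlgebraK; letI := T.instFieldFbar; letI := T.instAlgebraFbar
         letI := T.instAlgebraKFbar; letI := T.instIsElliptic
         ¬ (∀ p ∈ T.I.supportPrimes, ∀ v w : placesOver (fieldOfModuli T.E) p,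
            (Summit.ABC.IUTFork.DHData.ofInput T.I).logQloc p v = (Summit.ABC.IUTFork.DHData.ofInput T.I).logQloc p w)) →
        T.HullEstimateOf
          (((l : ℝ) + 1) / 4 *
            ((1 + 12 * (Cor22.dmod P : ℝ) / l) * (P.logDiff + Cor22.logCondAvoid P {2, l})
              + 2 * Real.log l + 52
              + 20 / 3 * Real.log (((2 ^ 12 * 3 ^ 3 * 5 * Cor22.dmod P : ℕ) : ℝ) * (l : ℝ))
                * (Nat.primeCounting (2 ^ 12 * 3 ^ 3 * 5 * Cor22.dmod P * l) : ℝ))))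
    : _root_.ABC :=
  abc_of_cor312NonarchOf_content_hregC
    (fun P hP l hl h5 hc h2 h5' h6 hct T hwin => h312 P hP l hl h5 hc h2 h5' h6 (szpiroBad_of_content h5 hct) T hwin) hNumC hregC

/-- **`abc_of_cor312OnSigma27_hregBad` — THE R14 RECUT of p468994's `abc_of_cor312OnSigma27` (guard-only delta `hreg ↦ hregBad`).** «Cor 3.12 on
Σ₂₇» (`Cor312OnSigma27` BY NAME) · [NUM, deep ∧ bad] `hNumBad` — p468994's / p450130's binder VERBATIM (the number-level Corollary ON the depth locus
of SZPIRO-BAD points) · [CONE-bad] `hregBad` — the hull estimate with print's `B_III(P, l)` off the slot-constant regime demanded ONLY at SZPIRO-BAD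
admissible `(P, l)`, abc-iut-s2-p2's binder of `ThetaPartII.ABC_of_cor312Bad_of_hullRegimeBad` VERBATIM ⟹ `ABC`. A λ-term over the θ-cut
`abc_of_cor312OnSigma27_content_hregC` (content guard ⟹ Szpiro-bad guard, `szpiroBad_of_content`). Explicit 3 = C312(Σ₂₇) · NUM(deep ∧ bad) ·
CONE(Szpiro-bad) — the same count as p468994 with ONLY the cone binder's guard changed; at every Szpiro-GOOD admissible `(P, l)` NOTHING is assumed
(abc-iut-c312-d1's `Cor22.ThetaVolumeDatumAt.cor312Of_of_szpiro`, abc-iut-s2-p2's `ThetaPartII.squeeze_of_szpiroGood`). `hregBad` is neither proved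
nor refuted as typed (`Conditional.not_hreg_v4` refutes only the blanket `hreg`). «`ABC` follows from these hypotheses AS TYPED»; no side taken on
[IUTchIII] Cor. 3.12 or [IUTchIV] Thm. 1.10. [cite: Mochizuki2012, IUTchIII Cor. 3.12 p. 173–174; IUTchIV Thm. 1.10 p. 22–23, Step (v) p. 27–28;
Cor. 2.2 (ii) p. 46] [claim: Mochizuki2012, status: disputed] -/
theorem abc_of_cor312OnSigma27_hregBad (h312 : Cor312OnSigma27)
    (hNumBad : ∀ (P : NFPoint), P ∈ UP → ∀ (l : ℕ), l.Prime → 5 ≤ l →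
      Cor22.AdmitsCore P → Cor22.CondP2 P l → Cor22.CondP5 P l → Cor22.CondP6 P l →
      -- ONLY at SZPIRO-BAD `(P, l)`: elsewhere `T.Cor312Of` is the theorem `Cor22.ThetaVolumeDatumAt.cor312Of_of_szpiro` (abc-iut-c312-d1)
      (((l : ℝ) + 5) / 4 < (Cor22.dmod P : ℝ) ∨
        6 * l * (((l : ℝ) + 5) - 4 * Cor22.dmod P) / (((l : ℝ) + 4) * ((l : ℝ) - 3))
            * (P.logDiff + (1 - 1 / (l : ℝ)) * Cor22.logCondAvoid P {2, l})
          + 6 * l * ((l : ℝ) + 5) / (((l : ℝ) + 4) * ((l : ℝ) - 3)) * Real.log Real.pi < Cor22.logQAvoid P {2, l}) →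
      ∀ (T : Cor22.ThetaVolumeDatumAt P l), letI := T.instFieldF; letI := T.instNumberFieldF; letI := T.instAlgebraF; letI := T.instFieldK;
        letI := T.instNumberFieldK; letI := T.instAlgebraK; letI := T.instFieldFbar; letI := T.instAlgebraFbar;
        letI := T.instAlgebraKFbar; letI := T.instIsElliptic;
      (∃ (pp : Nat.Primes) (_ : 2 < (pp : ℕ)) (i : Fin (thetaIndex (pilotDataOfK T.D T.K)).lstar)
          (x₀ : (thetaIndex (pilotDataOfK T.D T.K)).Fibre (.inr pp)),
        haveI : Fact (pp : ℕ).Prime := ⟨pp.2⟩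
        ((pp : ℕ) : ℝ) ^ ((((i : ℕ) : ℝ) + 2) * (4 + 2 * Real.logb (pp : ℕ) (Module.finrank ℚ T.K)) + 1) *
          ‖(exists_realising_qIdeles_pilotDataOfK T.D).choose pp x₀‖ ^ (((i : ℕ) + 1) ^ 2 - 1) < 1) → T.Cor312Of)
    -- [CONE, Szpiro-bad] the off-regime hull estimate with print's constant `B_III(P,l)`, demanded ONLY at SZPIRO-BAD admissible `(P, l)`
    (hregBad : ∀ P : NFPoint, P ∈ UP → ∀ l : ℕ, l.Prime → 5 ≤ l →
      Cor22.AdmitsCore P → Cor22.CondP2 P l → Cor22.CondP5 P l → Cor22.CondP6 P l →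
      (((l : ℝ) + 5) / 4 < (Cor22.dmod P : ℝ) ∨
        6 * l * (((l : ℝ) + 5) - 4 * Cor22.dmod P) / (((l : ℝ) + 4) * ((l : ℝ) - 3))
            * (P.logDiff + (1 - 1 / (l : ℝ)) * Cor22.logCondAvoid P {2, l})
          + 6 * l * ((l : ℝ) + 5) / (((l : ℝ) + 4) * ((l : ℝ) - 3)) * Real.log Real.pi < Cor22.logQAvoid P {2, l}) →
      ∀ T : Cor22.ThetaVolumeDatumAt P l,
        (letI := T.instFieldF; letI := T.instNumberFieldF; letI := T.instAlgebraF; letI := T.instFieldK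
         letI := T.instNumberFieldK; letI := T.instAlgebraK; letI := T.instFieldFbar; letI := T.instAlgebraFbar
         letI := T.instAlgebraKFbar; letI := T.instIsElliptic
         ¬ (∀ p ∈ T.I.supportPrimes, ∀ v w : placesOver (fieldOfModuli T.E) p,
            (Summit.ABC.IUTFork.DHData.ofInput T.I).logQloc p v = (Summit.ABC.IUTFork.DHData.ofInput T.I).logQloc p w)) →
        T.HullEstimateOf
          (((l : ℝ) + 1) / 4 *
            ((1 + 12 * (Cor22.dmod P : ℝ) / l) * (P.logDiff + Cor22.logCondAvoid P {2, l})
              + 2 * Real.log l + 52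
              + 20 / 3 * Real.log (((2 ^ 12 * 3 ^ 3 * 5 * Cor22.dmod P : ℕ) : ℝ) * (l : ℝ))
                * (Nat.primeCounting (2 ^ 12 * 3 ^ 3 * 5 * Cor22.dmod P * l) : ℝ))))
    : _root_.ABC :=
  abc_of_cor312OnSigma27_content_hregC h312
    (fun P hP l hl h5 hc h2 h5' h6 hct => hNumBad P hP l hl h5 hc h2 h5' h6 (szpiroBad_of_content h5 hct))
    (fun P hP l hl h5 hc h2 h5' h6 hct => hregBad P hP l hl h5 hc h2 h5' h6 (szpiroBad_of_content h5 hct))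

/-! ## §3. Composites with the first arrow `K2Target27`, and the EXPLICIT-4 recut over p477080's `k2Target27_of_certificates` -/

/-- **COMPOSITE Q2(27), recut: `K2Target27 ∧ HStar27OnSigma27 ∧ NUM(deep ∧ bad) ∧ CONE-bad ⟹ ABC`** — p468994's
`abc_of_k2Target27_of_hStar27OnSigma27` with ONLY the cone binder's guard changed (`hreg ↦ hregBad`); the first arrow an explicit TARGET binder
(`K2Target27`), «S restricted to Σ₂₇» by name (`HStar27OnSigma27`). Nothing asserted about any hypothesis; no side taken.
[cite: Mochizuki2012, IUTchIII Cor. 3.12 p. 173–174; IUTchIV Cor. 2.2 (ii) p. 46] [claim: Mochizuki2012, status: disputed] -/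
theorem abc_of_k2Target27_of_hStar27OnSigma27_hregBad (hK2 : K2Target27) (hS : HStar27OnSigma27)
    (hNumBad : ∀ (P : NFPoint), P ∈ UP → ∀ (l : ℕ), l.Prime → 5 ≤ l →
      Cor22.AdmitsCore P → Cor22.CondP2 P l → Cor22.CondP5 P l → Cor22.CondP6 P l →
      -- ONLY at SZPIRO-BAD `(P, l)`: elsewhere `T.Cor312Of` is the theorem `Cor22.ThetaVolumeDatumAt.cor312Of_of_szpiro` (abc-iut-c312-d1)
      (((l : ℝ) + 5) / 4 < (Cor22.dmod P : ℝ) ∨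
        6 * l * (((l : ℝ) + 5) - 4 * Cor22.dmod P) / (((l : ℝ) + 4) * ((l : ℝ) - 3))
            * (P.logDiff + (1 - 1 / (l : ℝ)) * Cor22.logCondAvoid P {2, l})
          + 6 * l * ((l : ℝ) + 5) / (((l : ℝ) + 4) * ((l : ℝ) - 3)) * Real.log Real.pi < Cor22.logQAvoid P {2, l}) →
      ∀ (T : Cor22.ThetaVolumeDatumAt P l), letI := T.instFieldF; letI := T.instNumberFieldF; letI := T.instAlgebraF; letI := T.instFieldK;
        letI := T.instNumberFieldK; letI := T.instAlgebraK; letI := T.instFieldFbar; letI := T.instAlgebraFbar;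
        letI := T.instAlgebraKFbar; letI := T.instIsElliptic;
      (∃ (pp : Nat.Primes) (_ : 2 < (pp : ℕ)) (i : Fin (thetaIndex (pilotDataOfK T.D T.K)).lstar)
          (x₀ : (thetaIndex (pilotDataOfK T.D T.K)).Fibre (.inr pp)),
        haveI : Fact (pp : ℕ).Prime := ⟨pp.2⟩
        ((pp : ℕ) : ℝ) ^ ((((i : ℕ) : ℝ) + 2) * (4 + 2 * Real.logb (pp : ℕ) (Module.finrank ℚ T.K)) + 1) *
          ‖(exists_realising_qIdeles_pilotDataOfK T.D).choose pp x₀‖ ^ (((i : ℕ) + 1) ^ 2 - 1) < 1) → T.Cor312Of)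
    -- [CONE, Szpiro-bad] the off-regime hull estimate with print's constant `B_III(P,l)`, demanded ONLY at SZPIRO-BAD admissible `(P, l)`
    (hregBad : ∀ P : NFPoint, P ∈ UP → ∀ l : ℕ, l.Prime → 5 ≤ l →
      Cor22.AdmitsCore P → Cor22.CondP2 P l → Cor22.CondP5 P l → Cor22.CondP6 P l →
      (((l : ℝ) + 5) / 4 < (Cor22.dmod P : ℝ) ∨
        6 * l * (((l : ℝ) + 5) - 4 * Cor22.dmod P) / (((l : ℝ) + 4) * ((l : ℝ) - 3))
            * (P.logDiff + (1 - 1 / (l : ℝ)) * Cor22.logCondAvoid P {2, l})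
          + 6 * l * ((l : ℝ) + 5) / (((l : ℝ) + 4) * ((l : ℝ) - 3)) * Real.log Real.pi < Cor22.logQAvoid P {2, l}) →
      ∀ T : Cor22.ThetaVolumeDatumAt P l,
        (letI := T.instFieldF; letI := T.instNumberFieldF; letI := T.instAlgebraF; letI := T.instFieldK
         letI := T.instNumberFieldK; letI := T.instAlgebraK; letI := T.instFieldFbar; letI := T.instAlgebraFbar
         letI := T.instAlgebraKFbar; letI := T.instIsElliptic
         ¬ (∀ p ∈ T.I.supportPrimes, ∀ v w : placesOver (fieldOfModuli T.E) p,
            (Summit.ABC.IUTFork.DHData.ofInput T.I).logQloc p v = (Summit.ABC.IUTFork.DHData.ofInput T.I).logQloc p w)) →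
        T.HullEstimateOf
          (((l : ℝ) + 1) / 4 *
            ((1 + 12 * (Cor22.dmod P : ℝ) / l) * (P.logDiff + Cor22.logCondAvoid P {2, l})
              + 2 * Real.log l + 52
              + 20 / 3 * Real.log (((2 ^ 12 * 3 ^ 3 * 5 * Cor22.dmod P : ℕ) : ℝ) * (l : ℝ))
                * (Nat.primeCounting (2 ^ 12 * 3 ^ 3 * 5 * Cor22.dmod P * l) : ℝ))))
    : _root_.ABC :=
  abc_of_cor312OnSigma27_hregBad (cor312OnSigma27_of_k2Target27 hK2 hS) hNumBad hregBad

/-- **COMPOSITE Q2(27), θ-cut: `K2Target27 ∧ HStar27OnSigma27 ∧ NUM(deep ∧ content) ∧ CONE-C ⟹ ABC`** (R14′ content line; `hNumC` / `hregC`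
are abc-iut-C-cert-1's binders VERBATIM). Nothing asserted about any hypothesis; no side taken.
[cite: Mochizuki2012, IUTchIII Cor. 3.12 p. 173–174; IUTchIV Thm. 1.10 Step (viii) p. 30] [claim: Mochizuki2012, status: disputed] -/
theorem abc_of_k2Target27_of_hStar27OnSigma27_content_hregC (hK2 : K2Target27) (hS : HStar27OnSigma27)
    -- [NUM, DEEP ∧ CONTENT] the NUMBER-level Corollary 3.12, ONLY at admissible data ON the depth locus of points ON the content locus
    (hNumC : ∀ (P : NFPoint), P ∈ UP → ∀ (l : ℕ), l.Prime → 5 ≤ l →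
      Cor22.AdmitsCore P → Cor22.CondP2 P l → Cor22.CondP5 P l → Cor22.CondP6 P l →
      -- ONLY on the CONTENT LOCUS of [IUTchIV] Thm. 1.10's display (`display_of_not_content`: off it the display holds for every `η > 0`)
      6 * ((1 + 20 * (Cor22.dmod P : ℝ) / l) * (P.logDiff + Cor22.logCondAvoid P {2, l}))
          + 120 * (2 ^ 12 * 3 ^ 3 * 5 * (Cor22.dmod P : ℝ) * l) < Cor22.logQAvoid P {2, l} →
      ∀ (T : Cor22.ThetaVolumeDatumAt P l), letI := T.instFieldF; letI := T.instNumberFieldF; letI := T.instAlgebraF; letI := T.instFieldK;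
        letI := T.instNumberFieldK; letI := T.instAlgebraK; letI := T.instFieldFbar; letI := T.instAlgebraFbar;
        letI := T.instAlgebraKFbar; letI := T.instIsElliptic;
      (∃ (pp : Nat.Primes) (_ : 2 < (pp : ℕ)) (i : Fin (thetaIndex (pilotDataOfK T.D T.K)).lstar)
          (x₀ : (thetaIndex (pilotDataOfK T.D T.K)).Fibre (.inr pp)),
        haveI : Fact (pp : ℕ).Prime := ⟨pp.2⟩
        ((pp : ℕ) : ℝ) ^ ((((i : ℕ) : ℝ) + 2) * (4 + 2 * Real.logb (pp : ℕ) (Module.finrank ℚ T.K)) + 1) *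
          ‖(exists_realising_qIdeles_pilotDataOfK T.D).choose pp x₀‖ ^ (((i : ℕ) + 1) ^ 2 - 1) < 1) → T.Cor312Of)
    -- [CONE, CONTENT] the hull estimate with print's `B_III(P,l)` off the slot-constant regime, ONLY at admissible points ON the content locus
    (hregC : ∀ P : NFPoint, P ∈ UP → ∀ l : ℕ, l.Prime → 5 ≤ l →
      Cor22.AdmitsCore P → Cor22.CondP2 P l → Cor22.CondP5 P l → Cor22.CondP6 P l →
      6 * ((1 + 20 * (Cor22.dmod P : ℝ) / l) * (P.logDiff + Cor22.logCondAvoid P {2, l}))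
          + 120 * (2 ^ 12 * 3 ^ 3 * 5 * (Cor22.dmod P : ℝ) * l) < Cor22.logQAvoid P {2, l} →
      ∀ T : Cor22.ThetaVolumeDatumAt P l,
        (letI := T.instFieldF; letI := T.instNumberFieldF; letI := T.instAlgebraF; letI := T.instFieldK
         letI := T.instNumberFieldK; letI := T.instAlgebraK; letI := T.instFieldFbar; letI := T.instAlgebraFbar
         letI := T.instAlgebraKFbar; letI := T.instIsElliptic
         ¬ (∀ p ∈ T.I.supportPrimes, ∀ v w : placesOver (fieldOfModuli T.E) p,
            (Summit.ABC.IUTFork.DHData.ofInput T.I).logQloc p v = (Summit.ABC.IUTFork.DHData.ofInput T.I).logQloc p w)) →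
        T.HullEstimateOf
          (((l : ℝ) + 1) / 4 *
            ((1 + 12 * (Cor22.dmod P : ℝ) / l) * (P.logDiff + Cor22.logCondAvoid P {2, l})
              + 2 * Real.log l + 52
              + 20 / 3 * Real.log (((2 ^ 12 * 3 ^ 3 * 5 * Cor22.dmod P : ℕ) : ℝ) * (l : ℝ))
                * (Nat.primeCounting (2 ^ 12 * 3 ^ 3 * 5 * Cor22.dmod P * l) : ℝ))))
    : _root_.ABC :=
  abc_of_cor312OnSigma27_content_hregC (cor312OnSigma27_of_k2Target27 hK2 hS) hNumC hregC


end Summit.ABC.IUTFork.Repair.RH.ReachLedgerQ2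

end
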